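import Mathlib
import Summits.KontsevichZagierPeriods.Zeta5Search.WedgeDictionary
import HarnessLib

/-!
# The dual series along a ray `b(a·n) = n·b(a)`: the decomposition holds for the whole family (record family included)

Cell `pub-zeta5` (HONEST FRAMING: systematic search; no irrationality claim unless certified), typer seat
generation 3.  OUR work (Summit side).  The cell's candidates are FAMILIES `a·n` (`n = 0, 1, 2, …`) of cellular
parameters; the dual parameters are linear, `b(n·a) = n·b(a)` (`bOfA_nsmul`), and the box/sum hypotheses of the
decomposition theorem are homogeneous.  Hence (`vwpDual_seven_nsmul_eq`): if `0 ≤ b₀`, `0 ≤ b_j ≤ b₀` and `Σ_j b_j ≤ 3b₀`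
(`d(b) ≥ 0`) then for EVERY `n`,
`F̃₇(n·b) = U(n·b)·ζ(5) + W(n·b)·ζ(3) − V(n·b)` with the canonical rational coefficients of `WedgeDictionary.lean` — the
dual very-well-poised forms of a whole family are three-term forms in `1, ζ(3), ζ(5)` (theorem, not observation).
Instances decided by the kernel: Brown–Zudilin's record direction `a = (8,16,10,15,12,16,18,13)` (`b = (41; 17,…,11)`) and
the Sect. 12 direction `a = (15,20,16,14,18,17,16,20)` (`b = (50; 15,20,14,18,16,17,17)`).
-/

noncomputable section

open Finset

namespace Summit.KontsevichZagierPeriods.Zeta5Search.WedgeDictionary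

open Summit.KontsevichZagierPeriods.Zeta5Search.DualSeries
open Literature.NumberTheory.Irrationality.BrownZudilin2022 (vwpDual bOfA recordVec)
open Literature.NumberTheory.Transcendental (zetaValue)

/-- The dual parameters are linear: `b(n·a) = n·b(a)` (pointwise). -/
theorem bOfA_nsmul (n : ℤ) (a : Fin 8 → ℤ) (j : ℕ) : bOfA (fun i => n * a i) j = n * bOfA a j := by
  match j with
  | 0 => simp [bOfA]; ring
  | 1 => simp [bOfA]; ring
  | 2 => simp [bOfA]
  | 3 => simp [bOfA]
  | 4 => simp [bOfA]; ring
  | 5 => simp [bOfA]; ring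
  | 6 => simp [bOfA]; ring
  | 7 => simp [bOfA]; ring
  | k + 8 => simp [bOfA]

/-- Scaling preserves the box: `0 ≤ b₀`, `0 ≤ b_j ≤ b₀` ⇒ `n·b` is in the box for every `n : ℕ`. -/
theorem inBox_nsmul (b : ℕ → ℤ) (h0 : 0 ≤ b 0) (hb : ∀ j ∈ range 7, 0 ≤ b (j + 1) ∧ b (j + 1) ≤ b 0) (n : ℕ) :
    InBox (fun j => (n : ℤ) * b j) := by
  have hn : (0 : ℤ) ≤ n := Nat.cast_nonneg n
  refine ⟨mul_nonneg hn h0, fun j hj => ⟨?_, ?_⟩⟩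
  · show 0 ≤ (n : ℤ) * b (j + 1)
    exact mul_nonneg hn (hb j hj).1
  · show (n : ℤ) * b (j + 1) ≤ (n : ℤ) * b 0 + 1
    nlinarith [(hb j hj).2, (hb j hj).1, mul_le_mul_of_nonneg_left (hb j hj).2 hn]

/-- Scaling preserves `d ≥ 0` in the form needed: `Σ_j n·b_j ≤ 3·(n·b₀) + 1`. -/
theorem sum_nsmul_le (b : ℕ → ℤ) (hsum : ∑ j ∈ range 7, b (j + 1) ≤ 3 * b 0) (n : ℕ) :
    ∑ j ∈ range 7, (n : ℤ) * b (j + 1) ≤ 3 * ((n : ℤ) * b 0) + 1 := by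
  rw [← mul_sum]
  nlinarith [hsum, (Nat.cast_nonneg n : (0 : ℤ) ≤ n)]

/-- **The decomposition along a ray**: for `b` with `0 ≤ b₀`, `0 ≤ b_j ≤ b₀`, `Σ_j b_j ≤ 3b₀` and every `n : ℕ`,
the series (34) at `n·b` converges and `F̃₇(n·b) = U(n·b)ζ(5) + W(n·b)ζ(3) − V(n·b)`. -/
theorem vwpDual_seven_nsmul_eq (b : ℕ → ℤ) (h0 : 0 ≤ b 0)
    (hb : ∀ j ∈ range 7, 0 ≤ b (j + 1) ∧ b (j + 1) ≤ b 0) (hsum : ∑ j ∈ range 7, b (j + 1) ≤ 3 * b 0) (n : ℕ) :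
    HasSum (term fun j => (n : ℤ) * b j)
        ((coeffU (fun j => (n : ℤ) * b j) : ℝ) * zetaValue 5 +
          (coeffW (fun j => (n : ℤ) * b j) : ℝ) * zetaValue 3 - (coeffV (fun j => (n : ℤ) * b j) : ℝ)) ∧
      vwpDual 7 (fun j => (n : ℤ) * b j) =
        (coeffU (fun j => (n : ℤ) * b j) : ℝ) * zetaValue 5 +
          (coeffW (fun j => (n : ℤ) * b j) : ℝ) * zetaValue 3 - (coeffV (fun j => (n : ℤ) * b j) : ℝ) :=
  vwp_decomposition _ (inBox_nsmul b h0 hb n) (sum_nsmul_le b hsum n)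

/-- The same for a cellular family `a·n`: `F̃₇(b(n·a)) ∈ ℚ + ℚζ(3) + ℚζ(5)` with the canonical coefficients, for every
`n`, as soon as `b(a)` satisfies `0 ≤ b₀`, `0 ≤ b_j ≤ b₀`, `Σ_j b_j ≤ 3b₀`. -/
theorem vwpDual_seven_family_eq (a : Fin 8 → ℤ) (h0 : 0 ≤ bOfA a 0)
    (hb : ∀ j ∈ range 7, 0 ≤ bOfA a (j + 1) ∧ bOfA a (j + 1) ≤ bOfA a 0)
    (hsum : ∑ j ∈ range 7, bOfA a (j + 1) ≤ 3 * bOfA a 0) (n : ℕ) :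
    vwpDual 7 (bOfA fun i => (n : ℤ) * a i) =
      (coeffU (bOfA fun i => (n : ℤ) * a i) : ℝ) * zetaValue 5 +
        (coeffW (bOfA fun i => (n : ℤ) * a i) : ℝ) * zetaValue 3 -
        (coeffV (bOfA fun i => (n : ℤ) * a i) : ℝ) := by
  have hfun : bOfA (fun i => (n : ℤ) * a i) = fun j => (n : ℤ) * bOfA a j := funext (bOfA_nsmul n a)
  rw [hfun]
  exact (vwpDual_seven_nsmul_eq (bOfA a) h0 hb hsum n).2

/-- **Brown–Zudilin's record family** `a·n`, `a = (8,16,10,15,12,16,18,13)` (`b(a) = (41; 17,16,15,14,13,12,11)`): for every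
`n`, `F̃₇(b(a·n)) = Uζ(5) + Wζ(3) − V` with the canonical rational coefficients (hypotheses decided by the kernel). -/
theorem vwpDual_seven_record (n : ℕ) :
    vwpDual 7 (bOfA fun i => (n : ℤ) * recordVec i) =
      (coeffU (bOfA fun i => (n : ℤ) * recordVec i) : ℝ) * zetaValue 5 +
        (coeffW (bOfA fun i => (n : ℤ) * recordVec i) : ℝ) * zetaValue 3 -
        (coeffV (bOfA fun i => (n : ℤ) * recordVec i) : ℝ) :=
  vwpDual_seven_family_eq recordVec (by decide) (by decide) (by decide) n

/-- The same for the Sect. 12 direction `a = (15,20,16,14,18,17,16,20)` (`b(a) = (50; 15,20,14,18,16,17,17)`). -/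
theorem vwpDual_seven_sect12 (n : ℕ) :
    vwpDual 7 (bOfA fun i => (n : ℤ) * (![15, 20, 16, 14, 18, 17, 16, 20] : Fin 8 → ℤ) i) =
      (coeffU (bOfA fun i => (n : ℤ) * (![15, 20, 16, 14, 18, 17, 16, 20] : Fin 8 → ℤ) i) : ℝ) * zetaValue 5 +
        (coeffW (bOfA fun i => (n : ℤ) * (![15, 20, 16, 14, 18, 17, 16, 20] : Fin 8 → ℤ) i) : ℝ) * zetaValue 3 -
        (coeffV (bOfA fun i => (n : ℤ) * (![15, 20, 16, 14, 18, 17, 16, 20] : Fin 8 → ℤ) i) : ℝ) :=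
  vwpDual_seven_family_eq _ (by decide) (by decide) (by decide) n

end Summit.KontsevichZagierPeriods.Zeta5Search.WedgeDictionary
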